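import Summits.BirchSwinnertonDyer.BirchSwinnertonDyer.Theses.SlopeDichotomyA2
import Summits.BirchSwinnertonDyer.Rank1Residual.X1.PadicSigmaThreeConsequences
import Literature.Barriers.BirchSwinnertonDyer.PAdicHeightNondegeneracyProofs
import Literature.NumberTheory.EllipticCurves.CyclotomicPAdicHeight
import Literature.NumberTheory.EllipticCurves.CanonicalPAdicHeightAdmissibleProofs
import Literature.NumberTheory.EllipticCurves.MordellWeilTheoremProofs
import Literature.NumberTheory.EllipticCurves.Rank1Residual.ClassX1
import Literature.NumberTheory.EllipticCurves.Rank1Residual.Typed.Basic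
import HarnessLib

/-!
# Crux `DegenerateLocusA2` (route `SlopeDichotomyA2`, item stmt-BirchSwinnertonDyer-19086) made CONCRETE

Support file (prover seat `bsd-schneider-i1-c2`, cell `bsd-schneider-ideate`; `--supports
stmt-BirchSwinnertonDyer-19086`; nothing here closes the item and nothing is asserted). The crux
`Summit.BirchSwinnertonDyer.BirchSwinnertonDyer.Theses.SlopeDichotomyA2.DegenerateLocusA2` quantifies
over an ABSTRACT datum: "some canonical `Dh : PAdicHeightData W p` violates `SchneiderConjecture Dh`".
This file proves, from theorems already in the tree and WITHOUT any named fact, what that hypothesis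
IS on a corner-A2 pair (`X1.TypeBRankOne W p`: `p > 2` good ordinary anomalous, `E[p]` reducible with
Greenberg–Vatsal parity, `ord_{s=1} L(E,s) = 1`):

* `exists_isCanonical_not_schneider_iff_cyclotomic` — at every ODD good ordinary prime the abstract
  hypothesis is literally `¬ SchneiderConjecture (W.cyclotomicPAdicHeight p)`, Schneider's conjecture
  failing for THE canonical cyclotomic height (existence and uniqueness of the canonical datum are
  tree THEOREMS: `X1.PadicSigmaThree.exists_isCanonical_odd`, `eq_cyclotomicPAdicHeight_of_fact
  exists_admissible_nsmul_holds`); no rank hypothesis.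
* `exists_isCanonical_not_schneider_iff_of_rank_one` /
  `exists_isCanonical_not_schneider_iff_height_zero` — in Mordell–Weil rank one it is moreover
  equivalent to the vanishing of an EXPLICIT `p`-adic number: some admissible point `P = (x, y)`
  (non-torsion, `P ∈ E₁(ℚ_p)`, sigma disc, non-singular reduction everywhere) has
  `W.canonicalPAdicHeight p P = log_p(den x) − 2 log_p σ_p(−x/y) = 0` (Mazur–Stein–Tate 2006 §1 /
  Stein–Wuthrich 2013 (4.1)). Inputs: the rank-one algebra of the barrier file
  (`not_schneiderConjecture_iff_of_rank_one`), the Mordell–Weil theorem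
  (`exists_isMordellWeilBasis_holds`) and admissible multiples (`exists_admissible_nsmul_holds`),
  all PROVED in the tree.
* `exists_not_schneider_of_rank_one` — the conjunct `Dh.IsCanonical` is load-bearing: in rank one the
  ZERO datum always violates `SchneiderConjecture`, so the crux without `IsCanonical` would be the
  whole leaf (the vacuity flag of `PAdicHeightData`, made explicit for this item).
* `degenerateLocusA2_iff_concrete` — UNCONDITIONAL reformulation of the crux: a prover of
  `DegenerateLocusA2` may assume, besides `X1.TypeBRankOne W p`, that Schneider fails for
  `W.cyclotomicPAdicHeight p` and (once `rank E(ℚ) = 1` is known) an admissible point of canonical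
  height `0`.
* `degenerateLocusA2_iff_missingPPartAt` — granted ONLY Gross–Zagier–Kolyvagin
  (`rank_eq_analyticRank_of_analyticRank_le_one`, the named fact every A2 theorem of the tree takes):
  the crux is EQUIVALENT to the cell's residual currency `Typed.MissingPPartAt W p`
  (`ord_p #Ш_an = ord_p #Ш`, `#Ш_an ∈ ℚ`) on the pairs `X1.TypeBRankOne W p` carrying an admissible
  point of canonical `p`-adic height `0`. This is the birth skeleton's split
  (`Cruxes/DegenerateLocusA2/Lines/birth.lean`: classical clauses + `p`-part) with the classical
  clauses discharged by name and the degenerate locus spelled out.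

Refutation-budget reading (seat report `REFUTATION-BUDGET-19086.md`, item evidence): a counterexample to
the crux is a globally minimal `W`, a prime `p` with `X1.TypeBRankOne W p`, an admissible `P` with
`log_p(den x(P)) = 2 log_p σ_p(z(P))` EXACTLY, and `ord_p #Ш_an ≠ ord_p #Ш` — the census (kit j244598,
all 2 797 class-pairs `N < 5·10⁵`) has no pair with the height even vanishing (max `v_3 = 7`).

References: Mazur–Stein–Tate 2006 §1 and Conj. 1.1 [MazurSteinTate2006]; Stein–Wuthrich 2013 §4.1
[SteinWuthrich2013]; Schneider 1985 [Schneider1985]; Miller 2011 Def. 1.1 [Miller2011LMS].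
-/

set_option autoImplicit false
set_option linter.dupNamespace false

noncomputable section

namespace Summit.BirchSwinnertonDyer.BirchSwinnertonDyer.Theorems.DegenerateLocusA2Concrete

open WeierstrassCurve Literature.NumberTheory.EllipticCurves
  Literature.NumberTheory.EllipticCurves.Rank1Residual
  Literature.NumberTheory.EllipticCurves.Rank1Residual.Typed
  Summit.BirchSwinnertonDyer.Rank1Residual
  Summit.BirchSwinnertonDyer.BirchSwinnertonDyer.Theses.SlopeDichotomyA2

variable {W : WeierstrassCurve ℚ} {p : ℕ} [Fact p.Prime]

/-! ### Bilinear bookkeeping -/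

/-- `⟨mP, mP⟩ = m·(m·⟨P, P⟩)` for any height datum (bilinearity). [folklore] -/
theorem pairing_nsmul_nsmul (D : PAdicHeightData W p) (m : ℕ) (P : W.toAffine.Point) :
    D.pairing (m • P) (m • P) = m • (m • D.pairing P P) := by
  rw [map_nsmul, map_nsmul, AddMonoidHom.nsmul_apply]

/-- In particular an isotropic point stays isotropic under multiplication. [folklore] -/
theorem pairing_nsmul_nsmul_eq_zero (D : PAdicHeightData W p) (m : ℕ) {P : W.toAffine.Point}
    (hPP : D.pairing P P = 0) : D.pairing (m • P) (m • P) = 0 := by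
  rw [pairing_nsmul_nsmul, hPP, smul_zero, smul_zero]

/-! ### The abstract hypothesis of the crux, at an odd good ordinary prime -/

/-- **At an odd prime of good ordinary reduction, "some canonical datum violates Schneider" is
Schneider's conjecture failing for THE canonical cyclotomic `p`-adic height `W.cyclotomicPAdicHeight p`**
(existence: `X1.PadicSigmaThree.exists_isCanonical_odd`; uniqueness: `eq_cyclotomicPAdicHeight_of_fact`
with the proved `exists_admissible_nsmul_holds`). No rank hypothesis, no named fact.
[cite: MazurSteinTate2006, Conj. 1.1] -/
theorem exists_isCanonical_not_schneider_iff_cyclotomic [W.IsElliptic] [W.IsGloballyMinimal]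
    (hp2 : p ≠ 2) (hgood : W.HasGoodReductionAtPrime p) (hord : ¬ (p : ℤ) ∣ W.frobeniusTrace p) :
    (∃ Dh : PAdicHeightData W p, Dh.IsCanonical ∧ ¬ SchneiderConjecture Dh) ↔
      ¬ SchneiderConjecture (W.cyclotomicPAdicHeight p) := by
  constructor
  · rintro ⟨Dh, hDh, hS⟩
    rwa [← eq_cyclotomicPAdicHeight_of_fact exists_admissible_nsmul_holds hDh]
  · intro hS
    exact ⟨W.cyclotomicPAdicHeight p,
      isCanonical_cyclotomicPAdicHeight (X1.PadicSigmaThree.exists_isCanonical_odd W p hp2 hgood hord), hS⟩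

/-! ### Rank one: the hypothesis is the vanishing of the sigma-formula height at an admissible point -/

/-- **Rank one.** For `W/ℚ` globally minimal elliptic with `rank_ℤ E(ℚ) = 1` and any prime `p`:
some CANONICAL datum violates `SchneiderConjecture` iff some canonical datum exists AND some admissible
point `P` has `W.canonicalPAdicHeight p P = 0`, i.e. `log_p(den x(P)) = 2 log_p σ_p(−x/y)`.
(→: `Reg_p = 0` gives a non-torsion isotropic `P₁` — the Mordell–Weil basis element,
`exists_pairing_self_eq_zero_of_rank_one` with the PROVED `exists_isMordellWeilBasis_holds` —, an
admissible multiple `mP₁` (`exists_admissible_nsmul_holds`) is again isotropic, and canonicity reads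
`ĥ_p(mP₁) = ⟨mP₁, mP₁⟩ = 0`; ←: an admissible point is non-torsion, `⟨P, P⟩ = ĥ_p(P) = 0`, and a
non-torsion isotropic point kills `Reg_p` in rank one, `not_schneiderConjecture_of_rank_one`.)
[cite: MazurSteinTate2006, §1 eq. (1.1) and Conj. 1.1] -/
theorem exists_isCanonical_not_schneider_iff_of_rank_one [W.IsElliptic] [W.IsGloballyMinimal]
    (hr : W.mordellWeilRank = 1) :
    (∃ Dh : PAdicHeightData W p, Dh.IsCanonical ∧ ¬ SchneiderConjecture Dh) ↔
      ∃ D : PAdicHeightData W p, D.IsCanonical ∧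
        ∃ P : W.toAffine.Point, W.IsAdmissible p P ∧ W.canonicalPAdicHeight p P = 0 := by
  constructor
  · rintro ⟨D, hD, hS⟩
    have hreg : padicRegulator D = 0 := by
      unfold SchneiderConjecture at hS
      exact not_not.mp hS
    obtain ⟨P, hP, hPP⟩ :=
      D.exists_pairing_self_eq_zero_of_rank_one hr W.exists_isMordellWeilBasis_holds hreg
    obtain ⟨m, -, hadm⟩ := exists_admissible_nsmul_holds W p P hP
    exact ⟨D, hD, m • P, hadm, (hD _ hadm).symm.trans (pairing_nsmul_nsmul_eq_zero D m hPP)⟩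
  · rintro ⟨D, hD, P, hP, h0⟩
    exact ⟨D, hD, D.not_schneiderConjecture_of_rank_one hr hP.1 ((hD P hP).trans h0)⟩

/-- **Rank one at an odd good ordinary prime**: the existence conjunct is a theorem
(`X1.PadicSigmaThree.exists_isCanonical_odd`), so "some canonical datum violates Schneider" iff SOME
ADMISSIBLE POINT HAS CANONICAL `p`-ADIC HEIGHT `0`. [cite: MazurSteinTate2006, §1 eq. (1.1) and Conj. 1.1] -/
theorem exists_isCanonical_not_schneider_iff_height_zero [W.IsElliptic] [W.IsGloballyMinimal]
    (hp2 : p ≠ 2) (hgood : W.HasGoodReductionAtPrime p) (hord : ¬ (p : ℤ) ∣ W.frobeniusTrace p)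
    (hr : W.mordellWeilRank = 1) :
    (∃ Dh : PAdicHeightData W p, Dh.IsCanonical ∧ ¬ SchneiderConjecture Dh) ↔
      ∃ P : W.toAffine.Point, W.IsAdmissible p P ∧ W.canonicalPAdicHeight p P = 0 := by
  rw [exists_isCanonical_not_schneider_iff_of_rank_one hr]
  constructor
  · rintro ⟨-, -, h⟩
    exact h
  · intro h
    exact ⟨W.cyclotomicPAdicHeight p,
      isCanonical_cyclotomicPAdicHeight (X1.PadicSigmaThree.exists_isCanonical_odd W p hp2 hgood hord), h⟩

/-- **On a corner-A2 pair** (`X1.TypeBRankOne W p`: `2 < p`, good, anomalous hence ordinary) of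
Mordell–Weil rank one: the crux's hypothesis iff an admissible point has canonical `p`-adic height `0`.
[cite: MazurSteinTate2006, §1 eq. (1.1) and Conj. 1.1] -/
theorem typeBRankOne_exists_not_schneider_iff_height_zero [W.IsElliptic] [W.IsGloballyMinimal]
    (hB : X1.TypeBRankOne W p) (hr : W.mordellWeilRank = 1) :
    (∃ Dh : PAdicHeightData W p, Dh.IsCanonical ∧ ¬ SchneiderConjecture Dh) ↔
      ∃ P : W.toAffine.Point, W.IsAdmissible p P ∧ W.canonicalPAdicHeight p P = 0 :=
  have hX := isClassX1_of_classX1 hB.1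
  exists_isCanonical_not_schneider_iff_height_zero hX.two_ne hX.hasGoodReductionAtPrime
    hX.not_dvd_frobeniusTrace hr

/-- **On a corner-A2 pair the crux's hypothesis is `¬ SchneiderConjecture (W.cyclotomicPAdicHeight p)`**
(no rank hypothesis). [cite: MazurSteinTate2006, Conj. 1.1] -/
theorem typeBRankOne_exists_not_schneider_iff_cyclotomic [W.IsElliptic] [W.IsGloballyMinimal]
    (hB : X1.TypeBRankOne W p) :
    (∃ Dh : PAdicHeightData W p, Dh.IsCanonical ∧ ¬ SchneiderConjecture Dh) ↔
      ¬ SchneiderConjecture (W.cyclotomicPAdicHeight p) :=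
  have hX := isClassX1_of_classX1 hB.1
  exists_isCanonical_not_schneider_iff_cyclotomic hX.two_ne hX.hasGoodReductionAtPrime
    hX.not_dvd_frobeniusTrace

/-! ### `IsCanonical` is load-bearing -/

/-- **Without `IsCanonical` the hypothesis would be idle**: in Mordell–Weil rank one the ZERO datum
`PAdicHeightData.zero W p` violates `SchneiderConjecture` (its `1 × 1` Gram determinant on the
Mordell–Weil basis — which exists, `exists_isMordellWeilBasis_holds` — is `0`). So
"`∃ Dh, ¬ SchneiderConjecture Dh`" holds on EVERY rank-one pair and the crux with the conjunct
`Dh.IsCanonical` deleted would be the whole leaf `TypeBRankOneUnridered`. [folklore] -/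
theorem exists_not_schneider_of_rank_one [W.IsElliptic] (hr : W.mordellWeilRank = 1) :
    ∃ Dh : PAdicHeightData W p, ¬ SchneiderConjecture Dh := by
  obtain ⟨P, hP⟩ := W.exists_isMordellWeilBasis_holds
  have i : Fin W.mordellWeilRank := ⟨0, by omega⟩
  exact ⟨PAdicHeightData.zero W p,
    (PAdicHeightData.zero W p).not_schneiderConjecture_of_rank_one hr (hP.not_isOfFinAddOrder_rat i)
      (PAdicHeightData.zero_pairing W p _ _)⟩

/-! ### The crux, reformulated -/

/-- **`DegenerateLocusA2`, concrete form (unconditional equivalence).** The crux holds iff: for every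
globally minimal `W`, prime `p` with `X1.TypeBRankOne W p` such that Schneider's conjecture FAILS for the
canonical cyclotomic height `W.cyclotomicPAdicHeight p`, and such that — whenever `rank_ℤ E(ℚ) = 1` —
some admissible `P` has `W.canonicalPAdicHeight p P = 0`, Miller's `BSDp W p` holds. (The two extra
hypotheses are CONSEQUENCES of the crux's abstract one, by the lemmas above, so assuming them is free.)
[cite: Miller2011LMS, Def. 1.1] [cite: MazurSteinTate2006, Conj. 1.1] -/
theorem degenerateLocusA2_iff_concrete :
    DegenerateLocusA2 ↔
      ∀ (W : WeierstrassCurve ℚ) [W.IsElliptic] [W.IsGloballyMinimal] (p : ℕ) [Fact p.Prime],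
        X1.TypeBRankOne W p → ¬ SchneiderConjecture (W.cyclotomicPAdicHeight p) →
          (W.mordellWeilRank = 1 →
            ∃ P : W.toAffine.Point, W.IsAdmissible p P ∧ W.canonicalPAdicHeight p P = 0) →
          BSDp W p := by
  constructor
  · intro h W _ _ p _ hB hS _
    exact h W p hB ((typeBRankOne_exists_not_schneider_iff_cyclotomic hB).mpr hS)
  · intro h W _ _ p _ hB hdeg
    exact h W p hB ((typeBRankOne_exists_not_schneider_iff_cyclotomic hB).mp hdeg)
      fun hr => (typeBRankOne_exists_not_schneider_iff_height_zero hB hr).mp hdeg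

/-- **`DegenerateLocusA2` in the cell's residual currency, granted Gross–Zagier–Kolyvagin.** Assuming only
the named fact `rank_eq_analyticRank_of_analyticRank_le_one` (`r_an ≤ 1 ⇒ rank = r_an ∧ Ш finite`; it
supplies Miller's clauses (i)–(ii) and the rank-one hypothesis of the lemmas above), the crux is
EQUIVALENT to: `Typed.MissingPPartAt W p` (`#Ш_an ∈ ℚ` and `ord_p #Ш_an = ord_p #Ш`) for every globally
minimal `W` and prime `p` with `X1.TypeBRankOne W p` and an ADMISSIBLE POINT OF CANONICAL `p`-ADIC
HEIGHT ZERO. This is the birth skeleton's decomposition (classical clauses + `p`-part on the degenerate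
locus) with the classical clauses discharged by name. [cite: Miller2011LMS, §1 and Def. 1.1]
[cite: MazurSteinTate2006, §1 eq. (1.1)] -/
theorem degenerateLocusA2_iff_missingPPartAt (hGZK : rank_eq_analyticRank_of_analyticRank_le_one) :
    DegenerateLocusA2 ↔
      ∀ (W : WeierstrassCurve ℚ) [W.IsElliptic] [W.IsGloballyMinimal] (p : ℕ) [Fact p.Prime],
        X1.TypeBRankOne W p →
          (∃ P : W.toAffine.Point, W.IsAdmissible p P ∧ W.canonicalPAdicHeight p P = 0) →
          MissingPPartAt W p := by
  constructor
  · intro h W _ _ p _ hB hP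
    obtain ⟨hrank, hfin⟩ := hGZK W hB.2.1.le
    have hr : W.mordellWeilRank = 1 := hrank.trans hB.2.1
    haveI : Finite W.sha := hfin
    exact missingPPartAt_of_bsdp W p
      (h W p hB ((typeBRankOne_exists_not_schneider_iff_height_zero hB hr).mpr hP))
  · intro h W _ _ p _ hB hdeg
    obtain ⟨hrank, -⟩ := hGZK W hB.2.1.le
    have hr : W.mordellWeilRank = 1 := hrank.trans hB.2.1
    exact bsdp_of_missingPPartAt W p hGZK hB.2.1.le
      (h W p hB ((typeBRankOne_exists_not_schneider_iff_height_zero hB hr).mp hdeg))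

/-- **One direction needs nothing**: granted GZK, a proof of `MissingPPartAt` on the concrete
degenerate locus gives the crux (the form a β-road / Fil⁰-road prover would supply).
[cite: Miller2011LMS, §1 and Def. 1.1] -/
theorem degenerateLocusA2_of_missingPPartAt (hGZK : rank_eq_analyticRank_of_analyticRank_le_one)
    (h : ∀ (W : WeierstrassCurve ℚ) [W.IsElliptic] [W.IsGloballyMinimal] (p : ℕ) [Fact p.Prime],
      X1.TypeBRankOne W p →
        (∃ P : W.toAffine.Point, W.IsAdmissible p P ∧ W.canonicalPAdicHeight p P = 0) →
        MissingPPartAt W p) :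
    DegenerateLocusA2 :=
  (degenerateLocusA2_iff_missingPPartAt hGZK).mpr h

end Summit.BirchSwinnertonDyer.BirchSwinnertonDyer.Theorems.DegenerateLocusA2Concrete

end
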